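import Summits.BirchSwinnertonDyer.Rank1Residual.F1Sign2.TranspositionDoorAtTwo
import Literature.NumberTheory.EllipticCurves.NonvanishingTwistsHoffsteinLuo
import Literature.NumberTheory.EllipticCurves.ManinConstantSemistablePrimewise
import Literature.NumberTheory.EllipticCurves.HeegnerPoints
import Literature.NumberTheory.EllipticCurves.HeegnerPointsRationalityProofs
import HarnessLib

/-!
# Route ByReductionTypeAtTwo, crux `RankOneAtTwoBigImageOddLocal` (stmt-BirchSwinnertonDyer-23715), line `one_door_law`:
# the line's carriers, its four door `Prop`s and its plumbing `Prop`s as closed, named, importable declarations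

Why this file exists (lead prover seat `bsd-line-fkl-p1` g6, 2026-08-28; pattern of `…RankOneAtTwoFklDefs.lean`, p606299).  The
line `Cruxes/RankOneAtTwoBigImageOddLocal/Lines/one_door_law.lean` (v7.1, planner `bsd-f1-sign2-an` g10, MEMO-an AN-27; skeleton
registered on the item, 6 stubs `stub_pub` / `stub_doorIndex` / `stub_doorValue` / `stub_doorSupply` / `stub_manin` / `stub_doorGlue`)
reduces the crux «BSD₂ for every non-CM `E/ℚ` of analytic rank `1` with `ρ_{E,2^n}` onto for all `n`, odd `#E(ℚ)_tors`, odd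
`∏ c_ℓ`» to ONE door law in Heegner-index currency (`DoorIndexLawAtTwo`, conjecture), the rank-`0` value law of the
`Sel₂`-trivial door twist (`DoorTwistValueAtTwo`), the supply of a `Sel₂`-trivialising door field (`DoorSupplyAtTwo`, theorem on
paper), the odd parametrisation constant (`S_manin`), the published inputs (`S_pub`) and a GLUE (`S_doorGlue`) over the PROVED tree
door `P2.bsdp_two_iff_of_heegner_rankOne`.  Until now these statements existed only inside the `Cruxes/` skeleton (not importable
from `Theorems/`).  Here they are stated VERBATIM (the registered v7.1 bodies, character for character; carriers and door Props =
`HOME/MEMO-an-data/g10/Sketch_v16.lean` of the planner) as closed declarations in ONE importable module, so that (i) the glue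
`S_doorGlue` can be PROVED in a `Theorems/` file by name (`…OneDoorGlue.lean`), (ii) a route file / the planner-of-record may
name `DoorIndexLawAtTwo` etc. as items, and (iii) the skeleton's stubs become one-line citations of these names.  Tags as in the
skeleton: `DoorIndexLawAtTwo` is the lens' CONJECTURE (`@[conjecture] def`, open obligation); the value / supply / Manin / published
statements are plain `def … : Prop` receptacles (nothing asserted).  No new object: every body is a statement over tree symbols
(`quadraticTwist`, `selmerGroup` via `twistSelmerTwoCard`, `NoRationalTwoTorsion`, `NotTwiceUpToTorsion`, `ModularParametrizationData`,
`HeegnerDatum`, `heegnerPointComplex`, `sha`, `torsionOrder`, `tamagawaProduct`, `mordellWeilRank`, `analyticRank`, `entireLFunction`,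
`realPeriodRat`, `frobeniusTrace`, `jacobiSym`, `gross_zagier`, `kolyvagin`, `heegnerPointComplex_mem_range_map`,
`rank_eq_analyticRank_of_analyticRank_le_one`, `hasEntireLFunction_rat`, `BSDp`).  This module imports NO Theses file
(no glue.cyclic-import).  BSD is not proved by any of this; nothing is asserted.

Dictionary (planner's docstrings below are verbatim; census references are the planner's ENGINE L, kit j299986 / j300076):
`t = transpCount W d`, `s = identCount W d` (door primes of transposition / identity type), `m` = the exact `2`-divisibility
exponent of the Heegner point modulo torsion (`HasTwoDivisibilityUpToTorsion`), and the law reads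
`2m + [Δ_W < 0] = ord₂ #Ш(W)[2^∞] + t + 2s`.  Edits against the skeleton text = exactly three cite-KEY normalisations to
`references.bib` keys (`arXiv:1411.4728` ↦ `TianYuanZhang2017`, `CaiLiZhai2020` ↦ `CaiLiZhai2019` — the same fix as -ty's
p608111 —, `arXiv:1703.02951` ↦ `Cesnavicius2018`); bodies untouched.  NOTE ON RECEPTACLES: the five CLOSED plain
`def … : Prop` receptacles (`DoorDivisibilityAtTwo`, `DoorTwistValueAtTwo`, `DoorSupplyAtTwo`, `S_manin`, `S_doorGlue`) carry their
references as plain locators (in the docstring and in a `/-! References … -/` line above each) instead of `[cite: …]` tags: they are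
the LINE'S STUB SIGNATURES (to be proved / promoted here), not published facts, and a cite-tagged closed `Prop` in a `Summits/` file
is relocated to `Literature/` by the gate (p610662/p610663, bounced relocation of exactly these five, 2026-08-28T06:51Z).
-/

set_option autoImplicit false

noncomputable section

open scoped Classical

set_option linter.dupNamespace false

namespace Summit.BirchSwinnertonDyer.BirchSwinnertonDyer.Theorems.RankOneAtTwoOneDoor

open Literature.NumberTheory.EllipticCurves Literature.NumberTheory.EllipticCurves.ModularForms
  Summit.BirchSwinnertonDyer.Rank1Residual.F1Sign2
  Summit.BirchSwinnertonDyer.Rank1Residual.F1Sign2.TranspositionDoor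

/-! ### Carriers and door Props (`Sketch_v16.lean` / `Lines/one_door_law.lean` v7.1 verbatim) -/

/-- **Door-admissible Heegner twist parameter** (any number of door primes).  `d < 0` squarefree, `d ≡ 1 (mod 8)` (so `2`
splits and `W^{(d)} ≅ W` over `ℚ₂`), every prime `q ∣ d` is a prime of good reduction (Frobenius on `W[2]` may be a
transposition, a 3-cycle or the identity), and `d` is a square modulo every odd bad prime (Heegner hypothesis; `W^{(d)} ≅ W`
over `ℚ_ℓ`).  `DescAdmissible` (`t = s = 0`), `TranspAdmissible` (`t = 1`, `s = 0`) and the two-transposition parameter of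
AN-26 are the special cases. [cite: MazurRubin2010, Def. 3.1 and Prop. 3.3] -/
def DoorAdmissible (W : WeierstrassCurve ℚ) [W.IsGloballyMinimal] (d : ℤ) : Prop :=
  d < 0 ∧ Squarefree d ∧ d % 8 = 1 ∧
    (∀ q : ℕ, q.Prime → (q : ℤ) ∣ d → ∀ _h : Fact q.Prime, W.HasGoodReductionAtPrime q) ∧
    (∀ ℓ : ℕ, ℓ.Prime → ℓ ≠ 2 → (∀ _h : Fact ℓ.Prime, ¬ W.HasGoodReductionAtPrime ℓ) → jacobiSym d ℓ = 1)

/-- `t(W, d)` = the number of TRANSPOSITION primes dividing `d`: good primes `q ∣ d` at which the `2`-division cubic of the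
minimal model has exactly one root, i.e. `(Δ_min / q) = −1` (`Ẽ(𝔽_q)[2] ≅ ℤ/2`, `c_q(W^{(d)}) = 2`). [cite: Kramer1981, Prop. 3] -/
def transpCount (W : WeierstrassCurve ℚ) [W.IsGloballyMinimal] (d : ℤ) : ℕ :=
  (d.natAbs.primeFactors.filter fun q => jacobiSym W.Δ.num q = -1).card

/-- `s(W, d)` = the number of IDENTITY primes dividing `d`: good primes `q ∣ d` at which the `2`-division cubic splits
completely, i.e. `(Δ_min / q) = +1` and `a_q(W)` even (`Ẽ(𝔽_q)[2] ≅ (ℤ/2)²`, `c_q(W^{(d)}) = 4`). [cite: Kramer1981, Prop. 3] -/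
def identCount (W : WeierstrassCurve ℚ) [W.IsGloballyMinimal] (d : ℤ) : ℕ :=
  (d.natAbs.primeFactors.filter fun q => jacobiSym W.Δ.num q = 1 ∧ Even (W.frobeniusTrace q)).card

/-- `P ∈ 2^m E(K) + E(K)_tors` and `2^{-m} P ∉ 2 E(K) + E(K)_tors`: the exact `2`-divisibility exponent of `P` modulo torsion
(for `E(K)` of rank one and `P` of infinite order: `m = v₂ [E(K) : ℤ P]`, the `2`-adic valuation of the Heegner index). -/
def HasTwoDivisibilityUpToTorsion (W : WeierstrassCurve ℚ) (K : Type) [Field K] [NumberField K]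
    (P : (W.baseChange K).toAffine.Point) (m : ℕ) : Prop :=
  ∃ Q : (W.baseChange K).toAffine.Point,
    P - (2 ^ m) • Q ∈ AddCommGroup.torsion (W.baseChange K).toAffine.Point ∧ NotTwiceUpToTorsion W K Q

/-- **AN-27 `DoorIndexLawAtTwo` — ONE DOOR LAW (CONJECTURE of this lens; the `2`-part of the Gross–Zagier–BSD ledger with the
`Ш(E)` side explicit).**  `W` globally minimal, non-CM, `ρ_{W,2^n}` onto for all `n`, odd torsion, odd Tamagawa product, analytic
rank one; `K` imaginary quadratic with `d_K` door-admissible, `Sel₂(W^{(d_K)}) = 0` and `L(W^{(d_K)},1) ≠ 0`; a parametrisation datum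
with ODD constant and `P ∈ E(K)` mapping to its complex Heegner point.  THEN `Ш(W)[2^∞]` is finite, `P` has an exact
`2`-divisibility exponent `m` modulo torsion, and `2m + [Δ_W < 0] = ord₂ #Ш(W)[2^∞] + t + 2s`.  Through the tree door
`P2.bsdp_two_iff_of_heegner_rankOne` + `DoorTwistValueAtTwo` this is `BSD₂(W)` for such `W` — for EVERY `W` of the slice at once
(no `Ш[2] = 0` hypothesis: the SHA-CORNER is inside).  Why it might fail: it is the `2`-part of BSD in rank one; the exact shape
is sensitive to any unaccounted `2` in the Gross–Zagier bookkeeping at the `I₀*` door primes (`c_q = 2, 4`) and to `Ш(W)[4] ≠ Ш(W)[2]`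
rows (first tested by ENGINE L: PARI `ellrank` certificates `#Ш(W)[2^∞] = 2^{s_W}` exactly).  Census: ENGINE L j299986 11/11, j300076.
[cite: GrossZagier1986, Thm. I.6.3 and V.§2] [cite: GrossLMS1991, Conj. 1.2 and §3] [cite: MazurRubin2010, Prop. 3.3]
[cite: JetchevSkinnerWan2017, §7.4.1] -/
@[conjecture] def DoorIndexLawAtTwo : Prop :=
  ∀ (W : WeierstrassCurve ℚ) [W.IsElliptic] [W.IsGloballyMinimal] [NeZero (W.conductorNorm ℤ)],
    ¬ W.HasCM → (∀ n : ℕ, W.HasSurjectiveModNGaloisRep ((2 ^ n : ℕ) : ℤ)) → Odd W.torsionOrder → Odd W.tamagawaProduct →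
    W.analyticRank = 1 →
    ∀ (K : Type) [Field K] [NumberField K], IsImaginaryQuadratic K →
      DoorAdmissible W (NumberField.discr K) → twistSelmerTwoCard W (NumberField.discr K) = 1 →
      (W.quadraticTwist (NumberField.discr K : ℚ)).entireLFunction 1 ≠ 0 →
      ∀ (Dt : ModularParametrizationData W (W.conductorNorm ℤ))
        (H : HeegnerDatum (W.conductorNorm ℤ) (NumberField.discr K)) (ι : K →+* ℂ)
        (P : (W.baseChange K).toAffine.Point),
        WeierstrassCurve.Affine.Point.map ι.toRatAlgHom P = heegnerPointComplex Dt H → ¬ (2 : ℤ) ∣ Dt.c →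
        Finite (AddCommGroup.primaryComponent W.sha 2) ∧
          ∃ m : ℕ, HasTwoDivisibilityUpToTorsion W K P m ∧
            2 * m + (if W.Δ < 0 then 1 else 0) =
              padicValNat 2 (Nat.card (AddCommGroup.primaryComponent W.sha 2)) +
                transpCount W (NumberField.discr K) + 2 * identCount W (NumberField.discr K)

/-! References of `DoorDivisibilityAtTwo`: [TianYuanZhang2017, Thm. 1.1 and §3] · [GrossZagier1986, V.§2] · [Kramer1981, Prop. 3] -/
/-- **DIV `DoorDivisibilityAtTwo` (the Selmer-free, `Ш`-free, `L`-free index half; THEOREM-CANDIDATE).**  For EVERY globally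
minimal `W` with `E(ℚ)[2] = 0` and every imaginary quadratic `K` with `d_K` door-admissible, the Heegner point of any
parametrisation datum is divisible by `2^{⌊(t+2s)/2⌋}` in `E(K)` modulo torsion.  (BSD-side: every other term of the ledger
`2m = ord₂#Ш(E) + ord₂#Ш(E^{(d)}) + t + 2s − [Δ<0] + 2 v₂ ∏c_ℓ` is `≥ 0` and `t ≡ [Δ<0] (2)`; a torsion `P` satisfies it
trivially.)  Named tool: genus characters of `K` and the congruence of the Heegner point with the sum of the genus points
modulo `2E(H_K^{gen})` (Tian–Yuan–Zhang type), `E(K)/2E(K) ↪ E(G)/2E(G)` from `E(G)[2] = 0`.  Why it might fail: the genus-point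
congruence is printed for the CM congruent-number family; for `t + 2s ≥ 4` it asserts divisibility by `4` and more, beyond any
single genus step.  Census ENGINE L: slack `2m − (t + 2s − [Δ<0] + 2v₂∏c_ℓ) ∈ {2, 4}` on 11/11 pilot rows.
(References, as plain locators — see the module note on receptacles: TianYuanZhang2017, Thm. 1.1 and §3; GrossZagier1986, V.§2; Kramer1981, Prop. 3.) -/
def DoorDivisibilityAtTwo : Prop :=
  ∀ (W : WeierstrassCurve ℚ) [W.IsElliptic] [W.IsGloballyMinimal] [NeZero (W.conductorNorm ℤ)], NoRationalTwoTorsion W →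
    ∀ (K : Type) [Field K] [NumberField K], IsImaginaryQuadratic K → DoorAdmissible W (NumberField.discr K) →
      ∀ (Dt : ModularParametrizationData W (W.conductorNorm ℤ))
        (H : HeegnerDatum (W.conductorNorm ℤ) (NumberField.discr K)) (ι : K →+* ℂ)
        (P : (W.baseChange K).toAffine.Point),
        WeierstrassCurve.Affine.Point.map ι.toRatAlgHom P = heegnerPointComplex Dt H →
        ∃ Q : (W.baseChange K).toAffine.Point,
          P - (2 ^ ((transpCount W (NumberField.discr K) + 2 * identCount W (NumberField.discr K)) / 2)) • Q ∈
            AddCommGroup.torsion (W.baseChange K).toAffine.Point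

/-! References of `DoorTwistValueAtTwo`: [Zhai2016, Thm. 1.1] · [KrizLi2019, Thm. 5.1] · [CaiLiZhai2019, Thm. 1.1] -/
/-- **`DoorTwistValueAtTwo` (value half: rank-`0` `BSD₂` of the `Sel₂`-trivial door twist, INCLUDING `L(E^{(d)},1) ≠ 0` — the
`2`-converse «`Sel₂ = 0 ⇒` analytic rank `0`», open in print for non-CM curves).**  In the door's currency
`q_d = L(E^{(d)},1)/Ω(E^{(d)}_min)`: `q_d ≠ 0` and `v₂ q_d = v₂ ∏ c_ℓ(E) + t + 2s` (`Ш(E^{(d)})[2] = 0`, `E^{(d)}(ℚ)[2] = 0`,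
`c_q(E^{(d)}) = 1 + #{roots of the 2-division cubic mod q}` at the `I₀*` door primes, `c_ℓ(E^{(d)}) = c_ℓ(E)` at `ℓ ∣ N`).
Modulo the converse this is the route's own `GoodOrdinary/Supersingular/Multiplicative/AdditiveRankZeroAtTwo` at `E^{(d)}` (same
reduction type at `2`).
(References, as plain locators — see the module note on receptacles: Zhai2016, Thm. 1.1; KrizLi2019, Thm. 5.1; CaiLiZhai2019, Thm. 1.1.) -/
def DoorTwistValueAtTwo : Prop :=
  ∀ (W : WeierstrassCurve ℚ) [W.IsElliptic] [W.IsGloballyMinimal], ¬ W.HasCM → NoRationalTwoTorsion W →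
    ∀ (d : ℤ), DoorAdmissible W d → twistSelmerTwoCard W d = 1 →
      ∀ (Wd : WeierstrassCurve ℚ) [Wd.IsElliptic] [Wd.IsGloballyMinimal] (Cd : WeierstrassCurve.VariableChange ℚ),
        Cd • W.quadraticTwist (d : ℚ) = Wd →
        ∃ qd : ℚ, Wd.entireLFunction 1 / (Wd.realPeriodRat : ℂ) = (qd : ℂ) ∧ qd ≠ 0 ∧
          padicValRat 2 qd = padicValNat 2 W.tamagawaProduct + transpCount W d + 2 * identCount W d

/-! References of `DoorSupplyAtTwo`: [MazurRubin2010, Prop. 3.3, Lemma 3.5 and Thm. 1.4] -/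
/-- **`DoorSupplyAtTwo` (THEOREM on paper: Mazur–Rubin 2010 Prop. 3.3 / Lemma 3.5 iterated inside the Heegner residue classes
+ Chebotarev; the lens' `TranspositionSupplyAtTwo` / `TwoTranspositionSupplyAtTwo` are the `dim Sel₂(E) = 1` cases).**  For
`W` of Mordell–Weil rank one with `E(ℚ)[2] = 0` there is an imaginary quadratic `K` with `(d_K, N) = 1`, the Heegner hypothesis,
`d_K` door-admissible and `Sel₂(W^{(d_K)}) = 0`.  Why it might fail: each door prime moves `dim Sel₂` by `±1` (transposition) or
by `0, ±2` (identity) and the signs must be steered while keeping `d ≡ 1 (8)` and `(d/ℓ) = 1` at the bad `ℓ` — bookkeeping in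
`ℚ(E[2]) K^{ab}`, in print only prime by prime. Census ENGINE L P27.5 (a trivialising door with `|d| ≤ 6000` for every corner curve).
(References, as plain locators — see the module note on receptacles: MazurRubin2010, Prop. 3.3, Lemma 3.5 and Thm. 1.4.) -/
def DoorSupplyAtTwo : Prop :=
  ∀ (W : WeierstrassCurve ℚ) [W.IsElliptic] [W.IsGloballyMinimal] [NeZero (W.conductorNorm ℤ)],
    NoRationalTwoTorsion W → W.mordellWeilRank = 1 →
    ∃ (K : Type) (_ : Field K) (_ : NumberField K),
      IsImaginaryQuadratic K ∧ DoorAdmissible W (NumberField.discr K) ∧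
      twistSelmerTwoCard W (NumberField.discr K) = 1 ∧
      Nat.Coprime (NumberField.discr K).natAbs (W.conductorNorm ℤ) ∧
      SatisfiesHeegnerHypothesis (W.conductorNorm ℤ) K

/-! ### The stubs -/

/-- S1 PUBLISHED (v6 verbatim): Gross–Zagier, Kolyvagin, `K`-rationality of the complex Heegner point for every parametrisation
datum (`heegnerPointComplex_mem_range_map`, a tree theorem), GZK over `ℚ`, modularity (tree named facts). -/
def S_pub : Prop :=
  (∀ (N : ℕ) [NeZero N] (W : WeierstrassCurve ℚ) (K : Type) [Field K] [NumberField K],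
      gross_zagier N W K ∧ kolyvagin N W K ∧ heegnerPointComplex_mem_range_map N W K) ∧
    rank_eq_analyticRank_of_analyticRank_le_one ∧ WeierstrassCurve.hasEntireLFunction_rat

/-- The `K`-rationality conjunct of `S_pub` is a tree theorem (Darmon 2004, Thm 3.6). -/
theorem pub_heegner_rationality (N : ℕ) [NeZero N] (W : WeierstrassCurve ℚ) (K : Type) [Field K] [NumberField K] :
    heegnerPointComplex_mem_range_map N W K :=
  heegnerPointComplex_mem_range_map_holds N W K

/-! References of `S_manin`: [Cesnavicius2018, Thm. 1.2] -/
/-- S5 odd parametrisation constant (v6 `S_manin` verbatim): on the `E(ℚ)[2] = 0` locus some parametrisation datum has ODD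
constant (theorem for `4 ∤ N`, OPEN for `4 ∣ N` — REF1 §42).
(References, as plain locators — see the module note on receptacles: Cesnavicius2018, Thm. 1.2.) -/
def S_manin : Prop :=
  ∀ (W : WeierstrassCurve ℚ) [W.IsElliptic] [W.IsGloballyMinimal] [NeZero (W.conductorNorm ℤ)],
    NoRationalTwoTorsion W → ∃ Dt : ModularParametrizationData W (W.conductorNorm ℤ), ¬ (2 : ℤ) ∣ Dt.c

/-- The slice with the Mordell–Weil rank made explicit (the glue's conclusion; the composition discharges `mordellWeilRank = 1`
from `analyticRank = 1` by GZK out of `S_pub`). -/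
def S_sliceMW : Prop :=
  ∀ (W : WeierstrassCurve ℚ) [W.IsElliptic] [W.IsGloballyMinimal],
    ¬ W.HasCM → (∀ n : ℕ, W.HasSurjectiveModNGaloisRep ((2 ^ n : ℕ) : ℤ)) → Odd W.torsionOrder → Odd W.tamagawaProduct →
    W.analyticRank = 1 → W.mordellWeilRank = 1 → BSDp W 2

/-! References of `S_doorGlue`: [GrossZagier1986, V.§2] · [Pal2012, Prop. 2.5 and Cor. 2.6] · [Miller2011LMS, Def. 1.1] -/
/-- S6 GLUE (M-sized Lean over the PROVED tree door `P2.bsdp_two_iff_of_heegner_rankOne`; ONE door, no case split on loci).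
Given the published inputs, the door index law, the twin value law, a supplied door field and an odd-constant datum: take `K` from
the supply (`(d_K, N) = 1`, Heegner hypothesis, `Sel₂(E^{(d_K)}) = 0`), `Dt` from `S_manin`, `H` from `nonempty_heegnerDatum_holds` /
`exists_dvd_sq_sub_discr_holds`, `ι : K →+* ℂ` (number fields embed), `P` from the rationality conjunct of `S_pub`, a globally
minimal model `Wd = Cd • W^{(d_K)}` and `q_d` from the value law (`q_d ≠ 0` gives `L(E^{(d_K)},1) ≠ 0`); then in
`ord₂(8 I² t_W² / (n k² t_K² c² w² q_d |u| c_W)) = ord₂ #Ш(E)`: `v₂ I = m` (rank one, `E(K)_tors` odd since `E(K)[2] = 0` for an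
irreducible `2`-division cubic over a quadratic field), `t_W, t_K, c` odd, `k = 1` (a rational point halvable in `E(K)` mod torsion
is halvable in `E(ℚ)`: `σQ − Q ∈ E(K)[2] = 0`), `n = #π₀(E(ℝ)) = 1 + [Δ > 0]`, `w = 2` (`d_K ≤ −7`), `|u| = 1` (tree theorem),
`v₂ q_d = v₂ c_W + t + 2s`: the valuation is `3 + 2m − [Δ>0] − 2 − (v₂c_W + t + 2s) − v₂c_W`… `= 2m + [Δ<0] − t − 2s = ord₂#Ш(E)[2^∞]`,
which is the law.
(References, as plain locators — see the module note on receptacles: GrossZagier1986, V.§2; Pal2012, Prop. 2.5 and Cor. 2.6; Miller2011LMS, Def. 1.1.) -/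
def S_doorGlue : Prop := S_pub → DoorIndexLawAtTwo → DoorTwistValueAtTwo → DoorSupplyAtTwo → S_manin → S_sliceMW

/-! ### APPEND (lead g6, skeleton v7.3): the RESHAPE of the value stub `DoorTwistValueAtTwo`

The value law mixes ONE open analytic input with kernel-provable arithmetic.  v7.3 splits it into
(V1) the rank-`0` `2`-CONVERSE for `Sel₂`-trivial door twists (`DoorTwistConverseAtTwo`, open in print for non-CM curves —
Kriz–Li 2019 Rem. 1.14; the lens' residual analytic risk, now ONE named statement), (V2) rank-`0` `BSD₂` of the twist = the
route's OWN four cruxes `GoodOrdinary/Multiplicative/Supersingular/AdditiveRankZeroAtTwo` BY NAME (no new statement; the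
skeleton names their conjunction), (V3) the TAMAGAWA BOOKKEEPING of the minimal twist model at the door primes
(`DoorTwistTamagawaAtTwo`: Tate's algorithm, type `I₀*` at every `q ∣ d`, `c_q = 1 + #{roots of the 2-division cubic mod q}`;
`c_ℓ` unchanged at `ℓ ∣ N` since `d ∈ (ℚ_ℓ^×)²`; kernel-provable from the tree's Tate algorithm, not yet done), and a glue
`doorTwistValueAtTwo_of` PROVED in `Theorems/…OneDoorValue.lean` (modularity → V1 → V2 → V3 → `DoorTwistValueAtTwo`; the
`Sel₂ = 0 ⇒ rank 0 ∧ E(ℚ)[2] = 0 ∧ Ш[2^∞] = 0` part is the tree's `SelmerTrivialCorankProofs`).  Nothing is asserted. -/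

/-- **(V1) `DoorTwistConverseAtTwo` — the rank-`0` `2`-CONVERSE for `Sel₂`-trivial door twists (OPEN).**  For `W/ℚ`
globally minimal, non-CM, with `E(ℚ)[2] = 0`, and a door-admissible `d` with `Sel₂(W^{(d)}) = 0`: `L(E^{(d)}, 1) ≠ 0`.
(`Sel₂ = 0` gives rank `0` and `Ш[2] = 0`; BSD predicts analytic rank `0`.  Printed `p`-converse theorems need `p` odd
(Skinner–Urban, Wan, Castella–Wan, Burungale–Skinner–Tian) or CM at `p = 2`; for non-CM curves at `p = 2` no proof is in
print — Kriz–Li 2019, Remark 1.14.  Open obligation; nothing asserted.) -/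
@[conjecture] def DoorTwistConverseAtTwo : Prop :=
  ∀ (W : WeierstrassCurve ℚ) [W.IsElliptic] [W.IsGloballyMinimal], ¬ W.HasCM → NoRationalTwoTorsion W →
    ∀ (d : ℤ), DoorAdmissible W d → twistSelmerTwoCard W d = 1 →
      (W.quadraticTwist (d : ℚ)).entireLFunction 1 ≠ 0

/-- **(V3) `DoorTwistTamagawaAtTwo` — Tamagawa numbers of the minimal twist model at the door primes (receptacle;
KERNEL-PROVABLE, Tate's algorithm case `I₀*`).**  For `W/ℚ` globally minimal elliptic, a door-admissible `d` and any
globally minimal model `Wd = Cd • W^{(d)}`: `ord₂ ∏_ℓ c_ℓ(Wd) = ord₂ ∏_ℓ c_ℓ(W) + t + 2s`.  Reason: at `ℓ ∣ N_W` (and at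
`ℓ = 2`) `d` is a non-zero square in `ℚ_ℓ` (`(d/ℓ) = 1` at odd bad `ℓ`, `d ≡ 1 (mod 8)` at `2`), so `Wd ≅ W` over `ℚ_ℓ` and
`c_ℓ(Wd) = c_ℓ(W)`; at a door prime `q ∣ d` (odd, good for `W`, `q ∥ d`) the twist has type `I₀*` with Tate's cubic
`P(T) = u³ ψ₂(T/u)` (`d = qu`), so `c_q(Wd) = 1 + #{roots of the 2-division cubic of W mod q} ∈ {1, 2, 4}` — `2` exactly
at the transposition primes (`(Δ/q) = −1`), `4` exactly at the identity primes (`(Δ/q) = +1`, `a_q` even), `1` at the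
3-cycle primes; all other primes are good for both.  (References, as plain locators: Tate 1975 §7 case 6; Silverman ATAEC
IV.9.4 Step 6 and Table 4.1; Kramer 1981 Prop. 3.  Not yet proved in the tree for a general `W`; the CM-7 family instance
is `GoldfeldGoodTwists.tamagawaProduct_goodTwist`.) -/
def DoorTwistTamagawaAtTwo : Prop :=
  ∀ (W : WeierstrassCurve ℚ) [W.IsElliptic] [W.IsGloballyMinimal],
    ∀ (d : ℤ), DoorAdmissible W d →
      ∀ (Wd : WeierstrassCurve ℚ) [Wd.IsElliptic] [Wd.IsGloballyMinimal] (Cd : WeierstrassCurve.VariableChange ℚ),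
        Cd • W.quadraticTwist (d : ℚ) = Wd →
        padicValNat 2 Wd.tamagawaProduct = padicValNat 2 W.tamagawaProduct + transpCount W d + 2 * identCount W d

/-- **(V2) `DoorTwistBSDTwoAtTwo` — rank-`0` `BSD₂` of the `Sel₂`-TRIVIAL door twist (receptacle).**  For `W/ℚ` globally
minimal, non-CM, with `E(ℚ)[2] = 0`, a door-admissible `d` with `Sel₂(W^{(d)}) = 0`, and any globally minimal model
`Wd = Cd • W^{(d)}` of analytic rank `0`: Miller's `BSD(Wd, 2)`.  Since `Sel₂(Wd) = 0` forces rank `0`, `Wd(ℚ)[2] = 0` and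
`Ш(Wd)[2^∞] = 0`, this is the single valuation `ord₂ (L(Wd,1)/Ω(Wd)) = ord₂ ∏_ℓ c_ℓ(Wd)`.  It is IMPLIED by the route's four
rank-`0` cruxes `GoodOrdinary/Multiplicative/Supersingular/AdditiveRankZeroAtTwo` BY NAME (glue
`doorTwistBSDTwoAtTwo_of_rankZero_cruxes` in `Theorems/…OneDoorValue.lean`) but is much weaker (trivial `2`-Selmer only);
printed instances: the quadratic-twist families of Zhai 2016 Thm 1.1 and Cai–Li–Zhai 2019 (references as plain locators).
Open receptacle; nothing asserted. -/
def DoorTwistBSDTwoAtTwo : Prop :=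
  ∀ (W : WeierstrassCurve ℚ) [W.IsElliptic] [W.IsGloballyMinimal], ¬ W.HasCM → NoRationalTwoTorsion W →
    ∀ (d : ℤ), DoorAdmissible W d → twistSelmerTwoCard W d = 1 →
      ∀ (Wd : WeierstrassCurve ℚ) [Wd.IsElliptic] [Wd.IsGloballyMinimal] (Cd : WeierstrassCurve.VariableChange ℚ),
        Cd • W.quadraticTwist (d : ℚ) = Wd → Wd.analyticRank = 0 → BSDp Wd 2

/-! ### APPEND #3 (lead g6): LINE v8.1 `one_door_analytic` (-an g11, AN-28) — the door chosen by NON-VANISHING, `s_d` floating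

Statements VERBATIM from `Cruxes/RankOneAtTwoBigImageOddLocal/Lines/one_door_analytic.lean` v8.1 (planner `bsd-f1-sign2-an` g11,
MEMO-an v1.21 AN-28; rc 0, 6 sorries = stubs, crux by name), so that its stubs can be landed BY NAME: `S_pubHL` (PRINT:
modularity as a newform + Hoffstein–Luo 1997), `DoorSupplyAnalyticAtTwo` (the HL door; a THEOREM modulo `S_pubHL`, proved in
`Theorems/…OneDoorAnalyticGlue.lean`), `@[conjecture] DoorIndexLawFullAtTwo` (AN-28, LOAD-BEARING; tagged here as the open obligation
it is — the only token change), `DoorTwinValueAtTwo` (value half with `s_d`), `S_rankZeroTwin` (rank-`0` `BSD₂` of every non-CM curve —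
the reduction-type-free form of the route's four rank-`0` cruxes), `DoorTwinValueAtTwoOfRankZero` (kernel twist arithmetic; PROVED by
width seat fkl-p2 g6, p616880 `doorTwinValueAtTwo_of_rankZeroTwin`), `S_doorGlueAn` (glue; PROVED, -an g11 / `…OneDoorAnalyticGlue.lean`).
Not copied: `S_rankZeroAtTwo` (a conjunction of ROUTE decls — it lives in the skeleton / the Theses-importing assembly file).
Nothing is asserted; BSD is not proved by any of this. -/

/-- PRINT (analytic side): the Modularity Theorem as a newform (`exists_isNewformOf`, BCDT 2001 Thm A) and Hoffstein–Luo 1997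
(Theorem with its "moreover" clause; the sieve refinement of Waldspurger / Bump–Friedberg–Hoffstein / Murty–Murty), both named
facts of the tree.
(References, as plain locators — see the module note on receptacles: HoffsteinLuo1997, Theorem (§1, pp. 435–436); BCDTJAMS2001, Thm. A.) -/
def S_pubHL : Prop :=
  exists_isNewformOf ∧ HoffsteinLuo1997_exists_twist_L_one_ne_zero

/-- **AN-28a `DoorSupplyAnalyticAtTwo` (Waldspurger–Hoffstein–Luo door; THEOREM modulo `S_pubHL`, proved in `Theorems/…OneDoorAnalyticGlue.lean`).**  Every
globally minimal `W` of analytic rank one has an imaginary quadratic `K` with `d_K` door-admissible (`d_K < 0` square-free,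
`d_K ≡ 1 (8)`, every `q ∣ d_K` good, `(d_K/ℓ) = 1` at the odd bad `ℓ`), `(d_K, N) = 1`, the Heegner hypothesis for `N`, and
`L(W^{(d_K)}, 1) ≠ 0`.  No Selmer condition on the twist.
(References, as plain locators — see the module note on receptacles: HoffsteinLuo1997, Theorem (§1, pp. 435–436); MurtyMurty1997, Ch. 6 §1, p. 96.) -/
def DoorSupplyAnalyticAtTwo : Prop :=
  ∀ (W : WeierstrassCurve ℚ) [W.IsElliptic] [W.IsGloballyMinimal] [NeZero (W.conductorNorm ℤ)],
    W.analyticRank = 1 →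
    ∃ (K : Type) (_ : Field K) (_ : NumberField K),
      IsImaginaryQuadratic K ∧ DoorAdmissible W (NumberField.discr K) ∧
      (W.quadraticTwist (NumberField.discr K : ℚ)).entireLFunction 1 ≠ 0 ∧
      Nat.Coprime (NumberField.discr K).natAbs (W.conductorNorm ℤ) ∧
      SatisfiesHeegnerHypothesis (W.conductorNorm ℤ) K

/-- **AN-28 `DoorIndexLawFullAtTwo` — the ONE DOOR LAW with the twin's `Ш` floating (CONJECTURE of this lens; LOAD-BEARING).**
`W` globally minimal, non-CM, `ρ_{W,2^n}` onto for all `n`, odd torsion, odd Tamagawa product, analytic rank one; `K` imaginary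
quadratic with `d_K` door-admissible and `L(W^{(d_K)},1) ≠ 0` (NO Selmer hypothesis on the twist); an odd-constant
parametrisation datum with `P ∈ E(K)` mapping to its complex Heegner point; `Wd` a globally minimal model of `W^{(d_K)}`.
THEN `P` has an exact `2`-divisibility exponent `m` modulo torsion and
`2m + [Δ_W < 0] = ord₂ #Ш(W)[2^∞] + ord₂ #Ш(Wd)[2^∞] + t + 2s` (pure identity; finiteness of the two `Ш[2^∞]` is NOT asserted
here — it comes from Kolyvagin (`S_pub`) for `W` in the glue and from rank-`0` `BSD₂(Wd)` on the value side; with both finite the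
`Nat.card`s are the true orders).  This is VERBATIM the right-hand side of the lead's per-datum kernel iff
`bsdp_two_iff_doorLawFull_at` (p615533, `Theorems/…OneDoorFull.lean`): modulo GZ/Kolyvagin/GZK/modularity + `BSDp Wd 2` +
twist Tamagawa arithmetic, `BSDp W 2 ↔` (this conclusion).  At a `Sel₂(W^{(d_K)}) = 0` door (`s_d = 0`) it is v7.x's
`DoorIndexLawAtTwo` minus the finiteness conjunct.  `K`-side meaning: Kolyvagin exactness `#Ш(E/K)[2^∞] = 4^{M₀}` (Gross's Question 11 + McCallum's structure
theorem at `p = 2`) after the Kramer / Milne–Cassels bookkeeping `ord₂#Ш(E/K) ↔ s_E + s_d + t + 2s − [Δ<0]`.  Why it might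
fail: it is the joint `2`-part of BSD of the door pair modulo rank-`0` `BSD₂(E^{(d)})`; any unaccounted `2` at the `I₀*` door
primes or in `Ш(E/K)[4] ≠ Ш(E/K)[2]` rows breaks the exact shape.  Census: ENGINE L j300076 P27.1, 597/597 certified rows
(431 `Sel₂`-trivial doors with `s_d = 0`, 166 control doors with `s_d = 2`), 0 violations.
[cite: GrossZagier1986, Thm. I.6.3 and V.§2] [cite: GrossLMS1991, Conj. 1.2 and §3] [cite: Kramer1981, Thm. 1 and Prop. 3] -/
@[conjecture] def DoorIndexLawFullAtTwo : Prop :=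
  ∀ (W : WeierstrassCurve ℚ) [W.IsElliptic] [W.IsGloballyMinimal] [NeZero (W.conductorNorm ℤ)],
    ¬ W.HasCM → (∀ n : ℕ, W.HasSurjectiveModNGaloisRep ((2 ^ n : ℕ) : ℤ)) → Odd W.torsionOrder → Odd W.tamagawaProduct →
    W.analyticRank = 1 →
    ∀ (K : Type) [Field K] [NumberField K], IsImaginaryQuadratic K →
      DoorAdmissible W (NumberField.discr K) →
      (W.quadraticTwist (NumberField.discr K : ℚ)).entireLFunction 1 ≠ 0 →
      ∀ (Dt : ModularParametrizationData W (W.conductorNorm ℤ))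
        (H : HeegnerDatum (W.conductorNorm ℤ) (NumberField.discr K)) (ι : K →+* ℂ)
        (P : (W.baseChange K).toAffine.Point),
        WeierstrassCurve.Affine.Point.map ι.toRatAlgHom P = heegnerPointComplex Dt H → ¬ (2 : ℤ) ∣ Dt.c →
        ∀ (Wd : WeierstrassCurve ℚ) [Wd.IsElliptic] [Wd.IsGloballyMinimal] (Cd : WeierstrassCurve.VariableChange ℚ),
          Cd • W.quadraticTwist (NumberField.discr K : ℚ) = Wd →
          ∃ m : ℕ, HasTwoDivisibilityUpToTorsion W K P m ∧
            2 * m + (if W.Δ < 0 then 1 else 0) =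
              padicValNat 2 (Nat.card (AddCommGroup.primaryComponent W.sha 2)) +
                padicValNat 2 (Nat.card (AddCommGroup.primaryComponent Wd.sha 2)) +
                transpCount W (NumberField.discr K) + 2 * identCount W (NumberField.discr K)

/-- **AN-28b `DoorTwinValueAtTwo` (value half = rank-`0` `BSD₂` of the door twist in the door's currency; NO `2`-converse).**
For `W` non-CM globally minimal with `E(ℚ)[2] = 0`, a door-admissible `d` with `L(W^{(d)},1) ≠ 0` and a globally minimal model
`Wd` of the twist: `Ш(Wd)[2^∞]` is finite and `q_d = L(Wd,1)/Ω(Wd)` is a non-zero rational with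
`v₂ q_d = v₂ ∏ c_ℓ(W) + t + 2s + ord₂ #Ш(Wd)[2^∞]` (`T(Wd)` odd; `c_q(Wd) = 1 + #{roots of the 2-division cubic mod q} ∈ {1,2,4}`
at the `I₀*` door primes; `c_ℓ(Wd) = c_ℓ(W)` at `ℓ ∣ N` since `d ∈ ℚ_ℓ^{×2}`).  = the route's `…RankZeroAtTwo` cruxes at `Wd`
+ `stub_twinArith`.
(References, as plain locators — see the module note on receptacles: Kramer1981, Prop. 3; Miller2011LMS, Def. 1.1.) -/
def DoorTwinValueAtTwo : Prop :=
  ∀ (W : WeierstrassCurve ℚ) [W.IsElliptic] [W.IsGloballyMinimal], ¬ W.HasCM → NoRationalTwoTorsion W →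
    ∀ (d : ℤ), DoorAdmissible W d → (W.quadraticTwist (d : ℚ)).entireLFunction 1 ≠ 0 →
      ∀ (Wd : WeierstrassCurve ℚ) [Wd.IsElliptic] [Wd.IsGloballyMinimal] (Cd : WeierstrassCurve.VariableChange ℚ),
        Cd • W.quadraticTwist (d : ℚ) = Wd →
        Finite (AddCommGroup.primaryComponent Wd.sha 2) ∧
        ∃ qd : ℚ, Wd.entireLFunction 1 / (Wd.realPeriodRat : ℂ) = (qd : ℂ) ∧ qd ≠ 0 ∧
          padicValRat 2 qd = padicValNat 2 W.tamagawaProduct + transpCount W d + 2 * identCount W d +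
            padicValNat 2 (Nat.card (AddCommGroup.primaryComponent Wd.sha 2))

/-- Rank-`0` `BSD₂` for every non-CM globally minimal curve (the reduction-type-free form of `S_rankZeroAtTwo`; equivalent to it
by the good-ordinary / supersingular / multiplicative / additive exhaustion, `rankZeroTwin_of_rankZeroAtTwo`). -/
def S_rankZeroTwin : Prop :=
  ∀ (V : WeierstrassCurve ℚ) [V.IsElliptic] [V.IsGloballyMinimal], ¬ V.HasCM → V.analyticRank = 0 → BSDp V 2

/-- KERNEL twist arithmetic (theorem-grade, M/L): the value law from rank-`0` `BSD₂` of the twin.  Content: `¬CM` and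
`analyticRank = 0` for `Wd` (`j`-invariance, `analyticRank_eq_zero_iff`), `BSDp Wd 2` unpacked at rank `0`
(`shaAn = L(1)·T²/(Ω·∏c)`), `T(Wd)` odd (`E^{(d)}[2] ≅ E[2]`), `v₂ ∏c(Wd) = v₂ ∏c(W) + t + 2s` (Tate's algorithm at the `I₀*`
door primes; `Wd ≅ W` over `ℚ_ℓ` at `ℓ ∣ 2N`).
(References, as plain locators — see the module note on receptacles: Kramer1981, Prop. 3.) -/
def DoorTwinValueAtTwoOfRankZero : Prop := S_pub → S_rankZeroTwin → DoorTwinValueAtTwo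

/-- GLUE of v8 (PROVED as `doorGlueAn` in `Theorems/…OneDoorAnalyticGlue.lean`): the lead's `S_doorGlue` with the HL supply and
`s_d` carried. -/
def S_doorGlueAn : Prop :=
  S_pub → DoorIndexLawFullAtTwo → DoorTwinValueAtTwo → DoorSupplyAnalyticAtTwo → S_manin → S_sliceMW

/-! ### APPEND #4 (lead g6): the SPLIT of the Manin stub `S_manin` — PRINT at `4 ∤ N`, OPEN only at additive level `4 ∣ N`

`S_manin` (odd parametrisation constant on the `E(ℚ)[2] = 0` locus) is a THEOREM for `4 ∤ N_E` modulo three named facts of the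
tree (modularity as a newform, Abbes–Ullmo 1996 Thm. A at `2 ∤ N`, Česnavičius 2018 Thm. 1.2 at `2 ∥ N`) — proved in
`Theorems/…OneDoorManin.lean` (`exists_modularParametrizationData_not_two_dvd`: the optimal curve's lattice-optimal datum has odd
constant, and an ODD integral multiplier `Λ_{E₀} → Λ_E` exists because `E[2]` is irreducible, `X11b.exists_int_mul_mem_lattice_not_dvd`)
— and OPEN only at `4 ∣ N_E`.  `s_manin_of : S_maninPub → ManinOddAdditiveLevelAtTwo → S_manin` (same file). -/

/-- PRINT for the Manin stub: modularity as a newform, Abbes–Ullmo 1996 Thm. A (`p ∤ N ⇒ p ∤ c`, used at `p = 2`), Česnavičius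
2018 Thm. 1.2 (`2 ∥ N ⇒ 2 ∤ c`) — named facts of the tree (`ManinConstantSemistablePrimewise.lean`).
(References, as plain locators: BCDTJAMS2001 Thm. A; AbbesUllmo1996 Thm. A; Cesnavicius2018 Thm. 1.2.) -/
def S_maninPub : Prop :=
  exists_isNewformOf ∧ abbesUllmo_not_dvd_maninConstant_of_not_dvd_level ∧
    cesnavicius_not_two_dvd_maninConstant_of_two_dvd_level

/-- **`ManinOddAdditiveLevelAtTwo` — odd parametrisation constant at ADDITIVE level `4 ∣ N` (OPEN; the residue of `S_manin`).**
For `W/ℚ` globally minimal elliptic with `E(ℚ)[2] = 0` and `4 ∣ N_E`: some modular parametrisation datum of level `N_E` has ODD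
constant.  Manin's conjecture (`c = 1` for the optimal curve) would give it together with the odd multiplier of
`…OneDoorManin.lean`; at `4 ∣ N` no printed result controls `ord₂ c` beyond Česnavičius–Neururer–Saha's bound by the modular
degree.  Open obligation; nothing asserted. [cite: Cesnavicius2018, Thm. 1.2 and §1 (Manin's conjecture)]
[cite: CesnaviciusNeururerSaha2023, Thm. 1.2] -/
@[conjecture] def ManinOddAdditiveLevelAtTwo : Prop :=
  ∀ (W : WeierstrassCurve ℚ) [W.IsElliptic] [W.IsGloballyMinimal] [NeZero (W.conductorNorm ℤ)],
    NoRationalTwoTorsion W → 4 ∣ W.conductorNorm ℤ →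
      ∃ Dt : ModularParametrizationData W (W.conductorNorm ℤ), ¬ (2 : ℤ) ∣ Dt.c

end Summit.BirchSwinnertonDyer.BirchSwinnertonDyer.Theorems.RankOneAtTwoOneDoor

end
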